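import Summits.Ventures.HodgeRepro.Night1ArtinProjector

/-!
# The closure sentences: «S4 for the corner products ⟹ every Hodge class of `A` is algebraic» (S3) and
«HC for `B_red` ⟹ `W_F(B)` algebraic» (Lemma R), as statements about an abstract subspace of algebraic classes

Blind re-derivation cell `pub-hodge-repro`, seat `night-1` (gen 6).  Imports night-1's `Night1ArtinProjector`
(Theorem 1 `jointEigenspaceOn_eq_iSup_map_andrePull`, Lemma R's Artin form
`weilWedgeProd_eq_aeval_projectorPoly_map_pullLin`).  Namespace `HodgeRepro.RouteC`.

The kernel has no cycle class map; «algebraic» is an abstract subspace `Alg` of `⋀^n ℂ^Y` with the closure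
properties the printed arguments use.  The two deductions of ROUTE.md §1 then read:

* **`jointEigenspaceOn_le_of_forall_map_andrePull_le`** (S3 ⟹ «S4 ⟹ S0»): if for every Pohlmann `2p`-set `Δ`
  the pull-back `f_Δ^*(W_F(A_Δ)) ⊗ ℂ` lies in `Alg` (S4 for the corner product `A_Δ` + functoriality of
  algebraic classes under `f_Δ^*`, André 1996 Thm 0.3 (ii)), then EVERY Hodge class of `A` in degree `2p`
  lies in `Alg` — Milne 2020 Theorem 1's use in ROUTE.md (S0 ⇐ S1 ∧ S2 ∧ S3 ∧ S4);
* `aeval_mem_of_stable` — a subspace stable under an operator is stable under every polynomial in it;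
* **`weilSpaceProd_le_of_stable_of_mem`** (LEMMA R's CONCLUSION): if `Alg` is stable under the action of the
  torus element `sepWeight` of `(F^ι ⊗ ℂ)^×` (the `F^ι`-correspondences) and contains the pull-backs
  `m^* e_{U_σ}` of the reduced Pohlmann wedges of `B_red` (HC in codimension `k` for `B_red` + functoriality
  under the sum map), then `W_F(B) ⊗ ℂ ≤ Alg` — «HC in codimension `p` for `B_red` ⇒ S4 for `B`»
  (ROUTE.md S3ᴿ), with the two printed inputs as the two hypotheses.

Nothing geometric is built: `Alg` is a hypothesis, not a construction.  Nothing here says anything about the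
status of the Hodge conjecture for CM abelian varieties, which is NOT proved.
-/

set_option autoImplicit false

open Finset Module Polynomial
open scoped Pointwise

namespace HodgeRepro.RouteC

open CMHodgeOn

/-! ### S3's closure sentence -/

section Andre

variable {G : Type*} [Group G] [DecidableEq G] [Fintype G] {X : Type*} [MulAction G X] [Fintype X]
  [DecidableEq X]

/-- **S3 ⟹ (S4 ⟹ S0) on the kernel**: if every pulled-back Weil space `f_Δ^*(W_F(A_Δ)) ⊗ ℂ` (`Δ` a Pohlmann
`2p`-set) lies in the subspace `Alg`, then the whole space of Hodge classes of `A` in degree `2p` does. -/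
theorem jointEigenspaceOn_le_of_forall_map_andrePull_le {c : G} (hc : IsComplexConj c) {Φ : Finset X}
    (hΦ : IsCMTypeOn c Φ) (p : ℕ) (Alg : Submodule ℂ (⋀[ℂ]^(2 * p) (X → ℂ)))
    (hAlg : ∀ (Δ : Finset X) (e : Fin (2 * p) ≃ ↥Δ), IsHodgeSetOn c Φ Δ →
      (weilSpaceProd G p e).map (andrePull Δ (2 * p)) ≤ Alg) :
    jointEigenspaceOn (fun g : G => g • Φ) (2 * p) p ≤ Alg := by
  rw [jointEigenspaceOn_eq_iSup_map_andrePull hc hΦ p]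
  exact iSup_le fun Δ => iSup_le fun e => iSup_le fun hΔ => hAlg Δ e hΔ

end Andre

/-! ### Polynomials in a stable operator -/

section Stable

variable {V : Type*} [AddCommGroup V] [Module ℂ V]

/-- A subspace stable under `f` is stable under every polynomial in `f`. -/
theorem aeval_mem_of_stable {f : Module.End ℂ V} {N : Submodule ℂ V} (hf : ∀ v ∈ N, f v ∈ N)
    (P : ℂ[X]) {v : V} (hv : v ∈ N) : aeval f P v ∈ N := by
  induction P using Polynomial.induction_on' with
  | add p q hp hq =>
    rw [map_add, LinearMap.add_apply]
    exact N.add_mem hp hq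
  | monomial n a =>
    rw [aeval_monomial, Module.End.mul_apply, Module.algebraMap_end_apply]
    refine N.smul_mem a ?_
    induction n with
    | zero => simpa using hv
    | succ m ih =>
      rw [pow_succ', Module.End.mul_apply]
      exact hf _ ih

end Stable

/-! ### Lemma R's closure sentence -/

section LemmaR

variable {G : Type*} [Group G] [DecidableEq G] [Fintype G] {ι J : Type*} [Fintype ι] [DecidableEq ι]
  [DecidableEq J]

/-- **LEMMA R's CONCLUSION ON THE KERNEL** («HC in codimension `p` for `B_red` ⇒ S4 for `B`», ROUTE.md S3ᴿ):
for injective `(cls, tw)`, if the subspace `Alg ⊆ ⋀^{2k} ℂ^{ι × G}` is stable under the torus element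
`sepWeight` (the action of `(F^ι ⊗ ℂ)^×` through correspondences) and contains the pull-backs `m^* e_{U_σ}`
of the reduced Pohlmann wedges of `B_red` along the sum map (HC for `B_red` + functoriality), then the
Weil space `W_F(B) ⊗ ℂ` lies in `Alg`. -/
theorem weilSpaceProd_le_of_stable_of_mem {cls : ι → J} {tw : ι → G}
    (hinj : Function.Injective fun i => (cls i, tw i)) {k : ℕ} (e : Fin (2 * k) ≃ ι)
    (Alg : Submodule ℂ (⋀[ℂ]^(2 * k) ((ι × G) → ℂ)))
    (hstable : ∀ ω ∈ Alg, exteriorPower.map (2 * k) (torusOn (sepWeight (ι × G))) ω ∈ Alg)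
    (hpull : ∀ σ : G, exteriorPower.map (2 * k) (pullLin (twistMap cls tw))
      (coordWedgeOn (2 * k) (reducedEnum cls tw e σ)) ∈ Alg) :
    weilSpaceProd G k e ≤ Alg := by
  rw [weilSpaceProd, Submodule.span_le]
  rintro _ ⟨σ, rfl⟩
  show weilWedgeProd e σ ∈ Alg
  rw [← weilWedgeProd_eq_aeval_projectorPoly_map_pullLin hinj e σ]
  exact aeval_mem_of_stable hstable _ (hpull σ)

end LemmaR

end HodgeRepro.RouteC
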